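import Summits.QuantumFields.BalabanUV.Beta.GAN24.ResponseColumnSlabFlux
import Summits.QuantumFields.BalabanUV.Beta.AxialDressingRootedBmKernel

/-!
# `BalabanUV.Beta.GAN24.TransverseFluxReflection` — binder row G-an2-4 ∕ (CONV-C), the (S) row ∕ (W-γ) one level up:
# **THE TRANSVERSE FLUX LEMMA — every single-coordinate weight on a coordinate `μ` OTHER than the data direction `μ′` reads ZERO on every component `κ ≠ μ′`
# of the `ℋ`-column of the centred co-dressed step resolvent:  `Σ'_u f(u_μ)·colH G_j Lc μ′ y κ u = 0`  (`Lc` odd, centred root, every `j`, `μ ≠ μ′`, `κ ≠ μ′`, bounded `f`)**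
# (G-an2-4 CRUX TEAM (2), seat `b2b-balaban-gan24-formalise-leaf-06` = the (γ) hand, gen 49, FILE (γ))

NOT IN PRINT; OUR BOOKKEEPING ([folklore] BY NAME: an2 gen 14's REFLECTION INVARIANCE of the centred block-mean co-dressed step resolvent
`AxialDressingRooted.refK_coDressKBmAt_KInvStep` (`refK (Φ Lc α) G_j = G_j`, `Lc` odd; leg map `ResolventReflection.Φ`: field legs by `bref`, multiplier legs by `mref`, signs `reflSign`),
its block-translation covariance `shiftK_coDressKBmAt_KInvStep` through `OneStepKernelFamily.colH_translate`, an2's `SecondOrderSplitDecay.summable_colH_mul_bdd`, and one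
reindexing of an absolutely convergent series by a lattice bijection; 0 `def`, 0 cited fact, 0 `def … : Prop`, 0 sorry).
HONEST FRAMING (cell contract, verbatim): «discharging `BetaPertH` makes Bałaban's UV stability UNCONDITIONAL — a real constructive-QFT result; it is NOT the continuum limit and NOT
the Clay problem.»  HONEST DEPENDENCY (verbatim): «continuum YM on T⁴ ⇐ BetaPertH ∧ nine spine estimates (0/9 proved); BetaPertH ⇐ (D1) ∧ (D4) ∧ CAP+tail; G-an2-4 gates asym,
D1 and NE2/3/4.»

WHY (R1, journal [GAN24LEAF06-G49-R1]; memo `HOME/b2b-balaban-gan24-formalise-leaf-06/g49/E30-E31-CENSUS.md`).  The closed form of the (γ) source pairing one level up rests on ONE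
vanishing, `(C2′) = 0`, whose mechanism is: the flux of the one-level response `H_0 n` through every hyperplane `u_μ = s` is supported on the EXIT slices `s ≡ Lc − 1`.  For the data
of direction `μ` this is leaf-06 g48 FILE F (`ResponseColumnSlabFlux.tsum_coordWeight_mul_colH`: the same-direction profile `𝟙[κ = μ]·cH_j·Lc^d·f(exit)`); for the data of the OTHER
directions `μ′ ≠ μ` it is THIS lemma — the g48 memo's open «TRANSVERSE FLUX ≡ 0» (E29 v11, E30 [F]: 1e-16 in D = 2, 8e-16 in D = 3 with the centred root; 4e-2 with an off-centre root).
THE PROOF IS A SYMMETRY ARGUMENT, dimension-free and level-free: reflect along the DATA axis `μ′`.  The centred co-dressed resolvent is reflection invariant (an2), the datum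
`(μ′, y)` goes to `(μ′, ȳ)` with the sign `reflSign μ′ μ′ = −1`, a field leg `(κ, u)` with `κ ≠ μ′` goes to `(κ, bref μ′ κ u)` with sign `+1`, and `bref μ′ κ` preserves the
coordinate `u_μ` (`μ ≠ μ′`); so the weighted column sum for the datum `y` is MINUS the one for `ȳ`.  But `ȳ − y` is supported on the coordinate `μ′`, and translating the datum by a
coarse vector `t` with `t_μ = 0` translates the column by `Lc•t` inside every hyperplane `u_μ = s` — the weighted sum is UNCHANGED.  Hence it equals its own negative.
* §1 `colH_refl` — the entrywise reflection law of the `ℋ`-columns: `colH G_j Lc μ′ y κ u = reflSign μ′ κ·reflSign μ′ μ′·colH G_j Lc μ′ (bref μ′ μ′ y) κ (bref μ′ κ u)`;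
  `colH_refl_of_ne` (`κ ≠ μ′`: a bare minus sign); `bref_apply_of_ne`, `bref_self_sub_apply_of_ne` (coordinate bookkeeping).
* §2 **`tsum_coordWeight_mul_colH_transverse`** — THE LEMMA: `Σ'_u f(u_μ)·colH G_j Lc μ′ y κ u = 0` for `μ ≠ μ′`, `κ ≠ μ′`, `f` bounded, `G_j = coDressKBmAt (toSite (ctrOff (d+1) Lc)) Lc (KInvStep Lc j)`,
  `Lc` odd; **`tsum_slabInd_mul_colH_transverse`** (`f = 𝟙_{s}`: the flux of the transverse components through every hyperplane `u_μ = s` vanishes).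
READING.  With FILE F: for EVERY datum direction, `Σ'_u 𝟙[u_μ = s]·colH G_j Lc μ′ y μ u = 𝟙[μ′ = μ]·cH_j·Lc^d·𝟙[s = Lc·y_μ + Lc − 1]` — the μ-flux of every response column lives on
the exit slice of its own block and nowhere else (centred root).  This is input (ii) of R1's (C2′) mechanism; it is NOT (C2′) and asserts NO value of any resolvent column beyond this
symmetry; NOTHING of (W-γ) at levels ≥ 1 ∕ (INV) ∕ (S) discharged; NEVER «G-an2-4 closed» as (CONV-C); NOT D1, NOT `BetaPertH`, NOT continuum, NOT Clay.  2026-08-23; no existing file touched.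
-/

noncomputable section

open Finset
open scoped BigOperators
open Literature.MathematicalPhysics.QuantumFieldTheory
open Literature.MathematicalPhysics.QuantumFieldTheory.Balaban1983to89
open Literature.MathematicalPhysics.QuantumFieldTheory.Balaban1983to89.Beta
open ExpKernelCalculus (Site MKer Decays)
open AffineAveraging (box toSite unitVec unitVec_apply)
open AveragingContoursRooted (ctrOff ctrOff_mem_box)
open PolarizationSign (reflSign)
open KernelReflection (refK refK_apply)
open ResolventReflection (bref bref_apply bref_bref mref_zsmul Φ Φ_r_inl Φ_r_inr Φ_s_inl Φ_s_inr reflSign_of_ne reflSign_self)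
open OneStepResolventKernel (Fib)
open OneStepKernelFamily (KInvStep colH colH_translate)
open Summit.QuantumFields.BalabanUV.Beta.AxialDressingRooted (coDressKBmAt decays_coDressKBmAt_KInvStep one_le_of_neZero refK_coDressKBmAt_KInvStep
  shiftK_coDressKBmAt_KInvStep)
open Summit.QuantumFields.BalabanUV.Beta.SecondOrderSplitDecay (summable_colH_mul_bdd)

namespace Summit.QuantumFields.BalabanUV.Beta.GAN24.TransverseFluxReflection

variable {d : ℕ} {Lc : ℕ} [NeZero Lc]

/-! ## §1 The entrywise reflection law of the `ℋ`-columns -/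

/-- [folklore] `bref α κ` does not move the coordinates other than `α`. -/
theorem bref_apply_of_ne (α κ : Fin (d + 1)) (x : Site (d + 1)) {i : Fin (d + 1)} (hi : i ≠ α) : bref α κ x i = x i := by
  rw [bref_apply, if_neg hi]

/-- [folklore] `bref α α y − y` vanishes off the coordinate `α`. -/
theorem bref_self_sub_apply_of_ne (α : Fin (d + 1)) (y : Site (d + 1)) {i : Fin (d + 1)} (hi : i ≠ α) : (bref α α y - y) i = 0 := by
  rw [Pi.sub_apply, bref_apply_of_ne α α y hi, sub_self]

/-- NOT IN PRINT; OUR BOOKKEEPING.  **THE ENTRYWISE REFLECTION LAW OF THE `ℋ`-COLUMNS** of `G_j = coDressKBmAt (toSite (ctrOff (d+1) Lc)) Lc (KInvStep Lc j)` (`Lc` odd, every `j`, every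
axis `α`): `colH G_j Lc μ′ y κ u = reflSign α κ·reflSign α μ′·colH G_j Lc μ′ (bref α μ′ y) κ (bref α κ u)` — an2's `refK_coDressKBmAt_KInvStep` read on the `(inl κ, inr μ′)` block at a
coarse second index (`mref_zsmul`). -/
theorem colH_refl (hLc : Odd Lc) (j : ℕ) (α μ' κ : Fin (d + 1)) (y u : Site (d + 1)) :
    colH (coDressKBmAt (toSite (ctrOff (d + 1) Lc)) Lc (KInvStep (d := d) Lc j)) Lc μ' y κ u
      = reflSign α κ * reflSign α μ' * colH (coDressKBmAt (toSite (ctrOff (d + 1) Lc)) Lc (KInvStep (d := d) Lc j)) Lc μ' (bref α μ' y) κ (bref α κ u) := by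
  have h := congrFun (congrFun (congrFun (congrFun (refK_coDressKBmAt_KInvStep (d := d) hLc j α) u) ((Lc : ℤ) • y)) (Sum.inl κ)) (Sum.inr μ')
  simp only [refK_apply, Φ_r_inl, Φ_r_inr, Φ_s_inl, Φ_s_inr, mref_zsmul] at h
  simp only [colH]
  exact h.symm

/-- NOT IN PRINT; OUR BOOKKEEPING.  **THE TRANSVERSE COMPONENTS FLIP SIGN UNDER THE REFLECTION ALONG THE DATA AXIS**: for `κ ≠ μ′`,
`colH G_j Lc μ′ y κ u = −colH G_j Lc μ′ (bref μ′ μ′ y) κ (bref μ′ κ u)`. -/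
theorem colH_refl_of_ne (hLc : Odd Lc) (j : ℕ) {μ' κ : Fin (d + 1)} (hκ : κ ≠ μ') (y u : Site (d + 1)) :
    colH (coDressKBmAt (toSite (ctrOff (d + 1) Lc)) Lc (KInvStep (d := d) Lc j)) Lc μ' y κ u
      = -colH (coDressKBmAt (toSite (ctrOff (d + 1) Lc)) Lc (KInvStep (d := d) Lc j)) Lc μ' (bref μ' μ' y) κ (bref μ' κ u) := by
  rw [colH_refl hLc j μ' μ' κ y u, reflSign_of_ne hκ, reflSign_self]
  ring

/-! ## §2 The transverse flux lemma -/

/-- NOT IN PRINT; OUR BOOKKEEPING.  **THE TRANSVERSE FLUX LEMMA** (`Lc` odd, centred root, every level `j`, every datum `(μ′, y)`, every field component `κ ≠ μ′`, every coordinate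
`μ ≠ μ′`, every BOUNDED `f : ℤ → ℝ`):  `Σ'_u f(u_μ)·colH G_j Lc μ′ y κ u = 0`.
Proof: reflection along `μ′` (`colH_refl_of_ne`) followed by the block translation `y ↦ bref μ′ μ′ y` (supported on the coordinate `μ′`, `colH_translate`); the composite relabelling
`u ↦ bref μ′ κ u − Lc•(bref μ′ μ′ y − y)` is a bijection of the field lattice preserving `u_μ`, so the (absolutely convergent) weighted sum equals its own negative. -/
theorem tsum_coordWeight_mul_colH_transverse (hLc : Odd Lc) (j : ℕ) {μ' μ κ : Fin (d + 1)} (hμ : μ ≠ μ') (hκ : κ ≠ μ') (f : ℤ → ℝ) {B : ℝ}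
    (hf : ∀ s, |f s| ≤ B) (y : Site (d + 1)) :
    ∑' u : Site (d + 1), f (u μ) * colH (coDressKBmAt (toSite (ctrOff (d + 1) Lc)) Lc (KInvStep (d := d) Lc j)) Lc μ' y κ u = 0 := by
  classical
  have hLc1 : 1 ≤ Lc := one_le_of_neZero Lc
  set G := coDressKBmAt (toSite (ctrOff (d + 1) Lc)) Lc (KInvStep (d := d) Lc j) with hGdef
  set t : Site (d + 1) := bref μ' μ' y - y with ht
  have htμ : t μ = 0 := bref_self_sub_apply_of_ne μ' y hμ
  -- reflection then translation: `colH(μ′,y)(κ,u) = −colH(μ′,y)(κ, bref μ′ κ u − Lc•t)`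
  have hpt : ∀ u : Site (d + 1), colH G Lc μ' y κ u = -colH G Lc μ' y κ (bref μ' κ u - (Lc : ℤ) • t) := by
    intro u
    rw [hGdef, colH_refl_of_ne hLc j hκ y u]
    have e : bref μ' μ' y = y + t := by rw [ht]; abel
    rw [e, colH_translate (shiftK_coDressKBmAt_KInvStep (toSite (ctrOff (d + 1) Lc)) j) μ' y t κ (bref μ' κ u)]
  -- the relabelling bijection and its invariance of the weight
  set e : Site (d + 1) ≃ Site (d + 1) := (Function.Involutive.toPerm (bref μ' κ) (bref_bref μ' κ)).trans (Equiv.subRight ((Lc : ℤ) • t)) with hedef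
  have he : ∀ u : Site (d + 1), e u = bref μ' κ u - (Lc : ℤ) • t := fun u => rfl
  have hw : ∀ u : Site (d + 1), (e u) μ = u μ := fun u => by
    rw [he, Pi.sub_apply, bref_apply_of_ne μ' κ u hμ, Pi.smul_apply, htμ, smul_zero, sub_zero]
  -- summability and the self-negation
  obtain ⟨δG, CG, hδG, hCG, hG⟩ := decays_coDressKBmAt_KInvStep (d := d) (ctrOff_mem_box hLc1) j
  have hs : Summable fun u : Site (d + 1) => f (u μ) * colH G Lc μ' y κ u :=
    (summable_colH_mul_bdd (N := Lc) ⟨δG, CG, hδG, hCG, hG⟩ (T := fun u => f (u μ)) (fun u => hf (u μ)) μ' y κ).congr fun u => mul_comm _ _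
  have hneg : ∑' u : Site (d + 1), f (u μ) * colH G Lc μ' y κ u = -∑' u : Site (d + 1), f (u μ) * colH G Lc μ' y κ u := by
    calc ∑' u : Site (d + 1), f (u μ) * colH G Lc μ' y κ u
        = ∑' u : Site (d + 1), -(f ((e u) μ) * colH G Lc μ' y κ (e u)) := tsum_congr fun u => by rw [hw u, he u, hpt u]; ring
      _ = -∑' u : Site (d + 1), f ((e u) μ) * colH G Lc μ' y κ (e u) := tsum_neg
      _ = -∑' v : Site (d + 1), f (v μ) * colH G Lc μ' y κ v := by rw [e.tsum_eq (fun v => f (v μ) * colH G Lc μ' y κ v)]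
  linarith

/-- NOT IN PRINT; OUR BOOKKEEPING.  **THE TRANSVERSE HYPERPLANE FLUX VANISHES**: `Σ'_u 𝟙[u_μ = s]·colH G_j Lc μ′ y κ u = 0` for `μ ≠ μ′`, `κ ≠ μ′` (`Lc` odd, centred root, every `j`, `s`, `y`)
— in particular (`κ = μ`) the flux of the `μ`-component of the response to a datum of direction `μ′ ≠ μ` through EVERY hyperplane `u_μ = s` is zero (E30 [F], D = 2 and 3). -/
theorem tsum_slabInd_mul_colH_transverse (hLc : Odd Lc) (j : ℕ) {μ' μ κ : Fin (d + 1)} (hμ : μ ≠ μ') (hκ : κ ≠ μ') (s : ℤ) (y : Site (d + 1)) :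
    ∑' u : Site (d + 1), (if u μ = s then (1 : ℝ) else 0) * colH (coDressKBmAt (toSite (ctrOff (d + 1) Lc)) Lc (KInvStep (d := d) Lc j)) Lc μ' y κ u = 0 :=
  tsum_coordWeight_mul_colH_transverse hLc j hμ hκ (fun z : ℤ => if z = s then (1 : ℝ) else 0) (B := 1) (fun z => by split <;> simp) y

end Summit.QuantumFields.BalabanUV.Beta.GAN24.TransverseFluxReflection

end
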